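import Literature.AlgebraicGeometry.Modules.ExtCohomologyComparison
import Literature.AlgebraicGeometry.Motives.CechH1ToSheafCohomologySurjective
import Literature.AlgebraicGeometry.Morphisms.CechModuleCoverIndependence
import Literature.AlgebraicGeometry.Morphisms.CechModuleRestrictOpen
import HarnessLib

/-!
# `Ȟ¹(𝒰, M) = 0` on ONE affine open cover ⇒ `H¹(X, M) = 0` and `Ext¹_{𝒪_X}(𝒪_X, M) = 0`
# (Hartshorne III Ex. 4.4 (c) with Thm. 4.5; Görtz–Wedhorn II, Cor. 21.81 and Thm. 22.9 in degree one)

Layer `Literature/AlgebraicGeometry/Modules`, namespace `Literature.AlgebraicGeometry.Modules`.  THEOREMS ONLY (no definition, no named fact,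
no instance, no `sorry`).  The BRIDGE between the tree's two degree-one currencies:

* the Čech groups `Ȟ¹(𝒰, M) = CechMH1 g M 𝒰` of a sheaf of `𝒪_X`-modules on a family of opens (`Morphisms/CechModule`, all ordered pairs), in
  which Serre's vanishing theorem (★ `Modules/SerreVanishingTwist`), cover independence (★ `Morphisms/CechModuleCoverIndependence`) and the
  `[n]`-trick (★ `AbelianVarieties/SymmetricAmpleH1Vanishing`) are written, and
* `Ext¹_{𝒪_X}(𝒪_X, M)` (Mathlib's `Ext` in `X.Modules`) = `H¹(X, M)` (★ `Modules/ExtCohomologyComparison`), the currency of the cohomology-and-base-change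
  sockets (★ `Morphisms/SectionsLiftOfFibreVanishing`, ★ `Morphisms/ProjectiveOverBaseOfFibresEmbedding`: `Subsingleton (Ext.{1} (unitModule X₀) E₀ 1)`).

For an affine-localizing (e.g. quasi-coherent) `M` and ONE affine open cover `𝒰` (any index type, not necessarily finite, no separatedness):

* §1 `forall_mem_cechOneCoboundaries_of_cechMZ1_le_cechMB1` — dictionary: the Čech `1`-cochains of the underlying abelian sheaf of `M`
  (★ `Motives/CechH1ToSheafCohomology`: `CechOneCochain`, `cechDOne`, `cechDZero`) ARE the cochains of `Morphisms/CechModule` (same sections, same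
  formulas, definitionally), so «`Ž¹ ⊆ B̌¹`» transfers;
* §2 **`subsingleton_H_one_of_subsingleton_cechMH1`** — `Ȟ¹(𝒰, M) = 0 ⇒ H¹(X, M) = 0`: every class of `H¹(X, M)` is a Čech class on some
  AFFINE open cover `𝔚` (★ `exists_cechToH_eq_of_isBasis` with the basis of affine opens — [Hartshorne1977] III Ex. 4.4 (c)), and `Ȟ¹(𝔚, M) = 0`
  by cover independence from `Ȟ¹(𝒰, M) = 0` ([Hartshorne1977] III Thm. 4.5, ★ `cechMZ1_le_cechMB1_iff_of_isAffineOpen`);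
  **`subsingleton_ext_one_of_subsingleton_cechMH1`** — hence `Ext¹_{𝒪_X}(𝒪_X, M) = 0` (★ `subsingleton_ext_unit_of_subsingleton_H`,
  [Hartshorne1977] III Prop. 6.3 (c)).

Cell `hodgecm-mathlib` (D-0151), F-DAG leaf F-2 (b) FIELD CASE, road of record «`[n]`-trick» (B-plan1 (g16) 2026-08-30T07:21:48Z), file V5 of
`B-provers/B-p05/g17/CENSUS-F2b-FieldVanishing.B-p05g17.md`; consumers: the ★ edition of V3 (`H¹(A, 𝒪(Θ)) = 0` in `Ext¹` form) and V4
`AbelianSchemes/AbelianSchemeLDeltaFibreH1Vanishing`.  Generic, count-neutral; HC_CM is proved only modulo the 7 printed citations until rung 0 closes —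
nothing here refers to it.

## References
* [Hartshorne1977] R. Hartshorne, *Algebraic Geometry*, GTM 52 (1977), III Ex. 4.4 (c), III Thm. 4.5, III Prop. 6.3 (c).
* [GortzWedhorn2023] U. Görtz, T. Wedhorn, *Algebraic Geometry II: Cohomology of Schemes* (2023), Cor. 21.81, Thm. 22.9.
* [StacksProject] The Stacks Project, Tag 01ED (Čech cohomology), Tag 01EW / 01X8 (Čech cohomology of quasi-coherent modules on affine covers).
-/

noncomputable section

universe w v u

open CategoryTheory CategoryTheory.Abelian AlgebraicGeometry TopologicalSpace Opposite

namespace Literature.AlgebraicGeometry.Modules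

open Literature.AlgebraicGeometry.Morphisms Literature.AlgebraicGeometry.Motives Literature.AlgebraicGeometry.HodgeTheory

variable {A : Type u} [CommRing A] {X : Scheme.{u}} (g : X ⟶ Spec (.of A)) (M : X.Modules)

/-! ## §1 Dictionary: abelian-sheaf Čech `1`-cochains of `M` are the module Čech `1`-cochains -/

section Dictionary

variable {κ : Type u} (W : κ → X.Opens)

/-- If `Ž¹(𝔚, M) ⊆ B̌¹(𝔚, M)` in the `CechMH1` currency, then every Čech `1`-cocycle of the underlying abelian sheaf of `M` on `𝔚` is a
coboundary — the two Čech complexes in degrees `≤ 2` have the same cochains `Γ(M, W_i ∩ W_j)` and the same differentials, definitionally.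
[cite: Hartshorne1977, III §4 Definition and Lemma 4.4] [cite: StacksProject, Tag 01ED] -/
theorem forall_mem_cechOneCoboundaries_of_cechMZ1_le_cechMB1 (h : cechMZ1 g M W ≤ cechMB1 g M W)
    (c : cechOneCocycles ((modulesToSheaf X).obj M) W) :
    (c : CechOneCochain ((modulesToSheaf X).obj M) W) ∈ cechOneCoboundaries ((modulesToSheaf X).obj M) W := by
  rw [mem_cechOneCoboundaries_iff]
  -- the same cochain, read in the module Čech complex
  let c' : CechMC1 g M W := fun i j => (c : CechOneCochain ((modulesToSheaf X).obj M) W) i j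
  have hc' : c' ∈ cechMZ1 g M W := by
    rw [mem_cechMZ1_iff]
    funext i j k
    exact (mem_cechOneCocycles_iff _ W _).1 c.2 i j k
  obtain ⟨b, hb⟩ := (mem_cechMB1_iff g M W c').1 (h hc')
  refine ⟨fun i => b i, fun i j => ?_⟩
  have hij := congr_fun (congr_fun hb i) j
  exact hij.symm

end Dictionary

/-! ## §2 `Ȟ¹ = 0` on one affine cover ⇒ `H¹ = 0` ⇒ `Ext¹ = 0` -/

section Head

variable (hM : IsAffineLocalizing M) {ι : Type v} (U : ι → X.Opens) (hU : ∀ i, IsAffineOpen (U i)) (hcov : ⨆ i, U i = ⊤)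

include hM hU hcov

/-- **`Ȟ¹(𝒰, M) = 0` on ONE affine open cover ⇒ `H¹(X, M) = 0`** for `M` affine-localizing (e.g. quasi-coherent): every class of `H¹(X, M)` is
the image of a Čech `1`-cocycle on an AFFINE open cover `𝔚` ([Hartshorne1977] III Ex. 4.4 (c), with the basis of affine opens), and
`Ȟ¹(𝔚, M) = 0` follows from `Ȟ¹(𝒰, M) = 0` by independence of the affine cover ([Hartshorne1977] III Thm. 4.5).
[cite: Hartshorne1977, III Ex. 4.4 (c) and III Thm. 4.5] [cite: GortzWedhorn2023, Cor. 21.81] -/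
theorem subsingleton_H_one_of_subsingleton_cechMH1 [h : Subsingleton (CechMH1 g M U)] :
    Subsingleton (((modulesToSheaf X).obj M).H 1) := by
  refine subsingleton_of_forall_eq 0 fun ξ => ?_
  -- a point-indexed AFFINE open cover `𝔚` and a cocycle `c` on it representing `ξ`
  obtain ⟨W, hW, -, hWaff, c, hc⟩ := exists_cechToH_eq_of_isBasis ((modulesToSheaf X).obj M) X.isBasis_affineOpens
    (fun _ => ⊤) (fun _ => trivial) ξ
  have hWaff' : ∀ x, IsAffineOpen (W x) := fun x => hWaff x
  rw [← hc, cechToH_eq_zero_iff]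
  -- `Ȟ¹(𝔚, M) = 0` from `Ȟ¹(𝒰, M) = 0` (both covers affine)
  have hle : cechMZ1 g M U ≤ cechMB1 g M U := (subsingleton_cechMH1_iff_cechMZ1_le_cechMB1 g U M).1 h
  have hle' : cechMZ1 g M W ≤ cechMB1 g M W :=
    (cechMZ1_le_cechMB1_iff_of_isAffineOpen g hM U W hU hWaff' hcov (iSup_eq_top_of_forall_mem W hW)).1 hle
  exact forall_mem_cechOneCoboundaries_of_cechMZ1_le_cechMB1 g M W hle' c

/-- **`Ȟ¹(𝒰, M) = 0` on ONE affine open cover ⇒ `Ext¹_{𝒪_X}(𝒪_X, M) = 0`** for `M` affine-localizing (e.g. quasi-coherent) — the form consumed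
by the cohomology-and-base-change sockets (`Subsingleton (Ext.{1} (unitModule X) M 1)` at universe `0`).
[cite: Hartshorne1977, III Ex. 4.4 (c), III Thm. 4.5 and III Prop. 6.3 (c)] [cite: GortzWedhorn2023, Cor. 21.81 and Thm. 22.9] -/
theorem subsingleton_ext_one_of_subsingleton_cechMH1 [HasExt.{w} X.Modules] [Subsingleton (CechMH1 g M U)] :
    Subsingleton (Ext.{w} (unitModule X) M 1) := by
  haveI := subsingleton_H_one_of_subsingleton_cechMH1 g M hM U hU hcov
  exact subsingleton_ext_unit_of_subsingleton_H M 1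

end Head

end Literature.AlgebraicGeometry.Modules

end
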